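import Summits.PneNP.PneNP.Theorems.KrwChromaticSteeringStrongCompositionLrxQuantitative
import Summits.PneNP.PneNP.Theorems.KrwChromaticSteeringStrongCompositionLrbRung

/-!
# Crux line `lrx-gluing` (stmt-PneNP-18538): THE RUNG C1|LRX, PROVED — assembly, inclusion of the LRB and LRAD rungs, non-vacuity

* §1 `strongCompositionLRX_of_quantitative` (VERBATIM the skeleton's kernel-checked composition `assembly_of_quantitative`,
  `Cruxes/StrongComposition/Lines/lrx_gluing.lean` §7): the LANDED S0⁺ (`KrwLrb.jointSubspaceHard_exists`, proved by the bench seat as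
  `KrwLrb.stub_jointSubspaceHard`, `…LrbJointSubspaceHard.lean`, `c = 3`) and the adversary bound `KrwLrx.LRXQuantitative`
  (`KrwLrx.lrxQuantitative_holds`, `…LrxQuantitative.lean`, `C = 1`) give the crux C1 with loss `(c + C + 2) (log₂ (m n) + 1) + t` on
  every class `LRX_t`: **`strongCompositionLRX : StrongCompositionLRX`**, the line's REGISTERED TARGET (rung).
* §2 `strongCompositionLRB_of_LRX`, `strongCompositionLRAD_of_LRX`: at budget `0` the rung is the landed rung C1|LRB
  (`KrwLrb.StrongCompositionLRB`), which contains the landed rung C1|LRAD; budget monotonicity `lrxOn_mono` (`LRX_t ⊆ LRX_{t'}`),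
  `lrx_of_lrb` (`LRB ⊆ LRX_t`).
* §3 Non-vacuity: independent play `KWTree.compose` is in every `LRX_t` (it is LRB, landed `KrwLrb.lrb_compose`), so inside each
  class the rung is matched from above up to its `O(log mn) + t` loss (`exists_lrx_solvesStrong`); and a genuine type-A path exists
  (`lrx_one_rowThenAffine`: a single-row test then the affine test on an entry of that row is `LRX_1`).

The link C1 ⟹ rung (`LrxGluing.lrx_of_strongComposition`) lives in the crux workfile only (it names the route decl; Theorems files of
this cone stay route-independent, cf. `…LradRouteLink.lean`).  Honest framing: `LRX_t` (label ∨ affine ∨ single-row node tests;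
total crossing weight `≤ t` per path) is a class-restricted, BUDGET-RELAXED form of Meir's open strong composition with `γ = 1`
([Meir2023], FOCS 2023 / arXiv:2306.00615): the loss `+ t` makes the statement empty on LRA (unbounded crossing weight), whose
`t`-free bound needs a different invariant (memo `Cruxes/StrongComposition/LensBarrierP4g21.md`, (BANK)); the crux item
stmt-PneNP-18538 (C1, all protocols) stays OPEN; nothing here bears on P vs NP.
-/

set_option linter.dupNamespace false -- `Summit.PneNP.PneNP.…`: summit = sub-problem name (D-0017 single-conjunct layout)
set_option autoImplicit false

namespace Summit.PneNP.PneNP.Theorems.KrwLrx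

open Literature.Computability.Complexity
open Summit.PneNP.PneNP.Theorems.KrwLrad
open Summit.PneNP.PneNP.Theorems.KrwLrb

universe u

/-! ## §1  Assembly: the landed S0⁺ and `LRXQuantitative` give the rung -/

section Assembly

/-- **Assembly of the rung** from S0⁺ and the adversary bound ALONE (VERBATIM the skeleton's kernel-checked composition
`assembly_of_quantitative`), loss `(c + C + 2) (log₂ (m n) + 1) + t` where `c` is the constant of S0⁺ and `C` the additive constant of
`LRXQuantitative` (the LRB assembly `KrwLrb.strongCompositionLRB_of_quantitative` with the budget `t` carried through).  Large `n` (`c (log₂ n + 1) + 2 ≤ n`, so `q = n − r − 1 ≥ 1`, `r = c (log₂ n + 1)`): S0⁺'s `g`,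
the bound in contrapositive form; tiny `n`: a dictator `g` and the `liftRows` embedding already fit. -/
theorem strongCompositionLRX_of_quantitative (h0 : jointSubspaceHard_exists) (hQ : LRXQuantitative) :
    StrongCompositionLRX := by
  obtain ⟨c, hc⟩ := h0
  obtain ⟨C, hQ⟩ := hQ
  refine ⟨c + C + 2, fun m n hn f hf => ?_⟩
  have hne : ∃ a b, f a = true ∧ f b = false := by
    obtain ⟨a, b, hab⟩ := hf
    cases ha : f a <;> cases hb : f b
    · rw [ha, hb] at hab; exact absurd rfl hab
    · exact ⟨b, a, hb, ha⟩
    · exact ⟨a, b, ha, hb⟩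
    · rw [ha, hb] at hab; exact absurd rfl hab
  have hm : 0 < m := by
    obtain ⟨a, b, hab⟩ := hf
    rcases Nat.eq_zero_or_pos m with h0 | h0
    · exfalso; subst h0; exact hab (congrArg f (funext fun i => i.elim0))
    · exact h0
  set L := Nat.log 2 (m * n) + 1 with hL
  have hLn : Nat.log 2 n + 1 ≤ L := by
    have : Nat.log 2 n ≤ Nat.log 2 (m * n) := Nat.log_mono_right (Nat.le_mul_of_pos_left n hm)
    omega
  set r := c * (Nat.log 2 n + 1) with hr
  have hcL : r ≤ c * L := Nat.mul_le_mul_left _ hLn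
  have hCL : C ≤ C * L := Nat.le_mul_of_pos_right C (by omega)
  have e1 : (c + C + 2) * L = c * L + C * L + 2 * L := by ring
  by_cases hbig : r + 2 ≤ n
  · -- large `n`: S0⁺'s inner function, budget `q = n - r - 1 ≥ 1`
    obtain ⟨g, hgen, hsub⟩ := hc n (by omega)
    refine ⟨g, fun t P hP hsol => ?_⟩
    set q := n - r - 1 with hq
    have hq1 : 1 ≤ q := by omega
    have hqn : q + r + 1 ≤ n := by omega
    by_contra hcon
    push Not at hcon
    set ℓ := P.depth + (c + C + 2) * L + t + 1 - n with hℓ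
    have hH : Hard (f ⁻¹' {true}) (f ⁻¹' {false}) ℓ := by
      intro Q hQs
      have hs : Q.Solves f := fun a b ha hb => hQs a (by simpa using ha) b (by simpa using hb)
      have := hcon Q hs
      omega
    have hmain := hQ m n q r ℓ t f g hne hgen hqn hsub hq1 hH P hP hsol
    omega
  · -- tiny `n` (`n ≤ r + 1 ≤ c L + 1`): a dictator and the `liftRows` protocol
    refine ⟨fun x => x ⟨0, by omega⟩, fun t P hP hsol => ?_⟩
    refine ⟨P.comap (KWTree.liftRows (fun _ => true) (fun _ => false))
        (KWTree.liftRows (fun _ => true) (fun _ => false)) Prod.fst,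
      KWTree.solves_comap_liftRows hsol rfl rfl, ?_⟩
    rw [KWTree.depth_comap]
    omega

/-- **THE RUNG C1|LRX, PROVED**: Meir's strong composition statement with `γ = 1` (crux C1 `Theses.KrwChromaticSteering.StrongComposition`:
`g` existential, loss `O(log mn)`), with the loss relaxed by the crossing budget `t`, holds for every protocol of every class `LRX_t` —
the assembly applied to the LANDED S0⁺ `KrwLrb.stub_jointSubspaceHard` (bench seat, p715652, `c = 3`) and `lrxQuantitative_holds`
(`C = 1`): loss `6 (log₂ (m n) + 1) + t`.  This is the registered target `StrongCompositionLRX` of line `lrx-gluing` (the skeleton's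
`StrongCompositionLRX_of`); the `t`-free LRA bound and C1 itself (all protocols) stay open. -/
theorem strongCompositionLRX : StrongCompositionLRX :=
  strongCompositionLRX_of_quantitative Summit.PneNP.PneNP.Theorems.KrwLrb.stub_jointSubspaceHard lrxQuantitative_holds

end Assembly

/-! ## §2  The new rung contains the proved ones: rung C1|LRX ⟹ rung C1|LRB ⟹ rung C1|LRAD; budget monotonicity -/

section Links

variable {m n : ℕ}


/-- The rung at budget `0` is the landed rung C1|LRB (`KrwLrb.StrongCompositionLRB`; `LRBDisciplined g P` is `LRXDisciplined g 0 P`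
by definition). -/
theorem strongCompositionLRB_of_LRX (h : StrongCompositionLRX) :
    Summit.PneNP.PneNP.Theorems.KrwLrb.StrongCompositionLRB := by
  obtain ⟨c, hc⟩ := h
  refine ⟨c, fun m n hn f hf => ?_⟩
  obtain ⟨g, hg⟩ := hc m n hn f hf
  refine ⟨g, fun P hP hsol => ?_⟩
  simpa using hg 0 P hP hsol

/-- … and hence the landed rung C1|LRAD (`KrwLrad.StrongCompositionLRAD`, via `KrwLrb.strongCompositionLRAD_of_LRB`). -/
theorem strongCompositionLRAD_of_LRX (h : StrongCompositionLRX) : StrongCompositionLRAD :=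
  strongCompositionLRAD_of_LRB (strongCompositionLRB_of_LRX h)

/-- Budget monotonicity `LRX_t ⊆ LRX_{t'}` (`t ≤ t'`) below any typing [adapted from the planner's `P4g20X.lrxOn_mono`]. -/
theorem lrxOn_mono (g : (Fin n → Bool) → Bool) :
    ∀ (P : KWTree (Fin m × Fin n)) (t t' : ℕ) (σ : Fin m → RowTypeX), t ≤ t' →
      LRXDisciplinedOn g t σ P → LRXDisciplinedOn g t' σ P
  | .leaf _, _, _, _, _, _ => trivial
  | .alice _ P Q, t, t', σ, htt, h => by
    obtain ⟨σ', w, hnode, hw, hP, hQ⟩ := h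
    exact ⟨σ', w, hnode, hw.trans htt, lrxOn_mono g P _ _ σ' (by omega) hP, lrxOn_mono g Q _ _ σ' (by omega) hQ⟩
  | .bob _ P Q, t, t', σ, htt, h => by
    obtain ⟨σ', w, hnode, hw, hP, hQ⟩ := h
    exact ⟨σ', w, hnode, hw.trans htt, lrxOn_mono g P _ _ σ' (by omega) hP, lrxOn_mono g Q _ _ σ' (by omega) hQ⟩

/-- `LRB ⊆ LRX_t` for every `t`. -/
theorem lrx_of_lrb {g : (Fin n → Bool) → Bool} {P : KWTree (Fin m × Fin n)} (h : LRBDisciplined g P) (t : ℕ) :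
    LRXDisciplined g t P :=
  lrxOn_mono g P 0 t _ (Nat.zero_le t) h

end Links

/-! ## §3  Non-vacuity: independent play is in every `LRX_t` (it is LRB, landed `KrwLrb.lrb_compose`), so inside each class the rung
is matched from above up to its `O(log mn) + t` loss; and `LRX_1 \ LRX_0`-typings exist (a single-row test followed by an affine test
through that row is a legal `LRX_1` path). -/

section NonVacuity

variable {m n : ℕ}

/-- **Independent play is `LRX_t`** for every budget `t`. -/
theorem lrx_compose (g : (Fin n → Bool) → Bool) (R : KWTree (Fin n)) (Q : KWTree (Fin m)) (t : ℕ) :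
    LRXDisciplined g t (KWTree.compose g R Q) :=
  lrx_of_lrb (Summit.PneNP.PneNP.Theorems.KrwLrb.lrb_compose g R Q) t

/-- From any `KW_f` protocol `Q` and `KW_g` protocol `R`, an `LRX_t` protocol for the strong game of depth `Q.depth + R.depth + 1`. -/
theorem exists_lrx_solvesStrong {f : (Fin m → Bool) → Bool} {g : (Fin n → Bool) → Bool}
    {Q : KWTree (Fin m)} {R : KWTree (Fin n)} (hQ : Q.Solves f) (hR : R.Solves g) (t : ℕ) :
    ∃ P : KWTree (Fin m × Fin n), LRXDisciplined g t P ∧ P.SolvesStrong f g ∧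
      P.depth = Q.depth + R.depth + 1 :=
  ⟨KWTree.compose g R Q, lrx_compose g R Q t, KWTree.solvesStrong_compose hQ hR, KWTree.depth_compose g R Q⟩

/-- A genuine type-A path: a single-row test on row `i` (making it combinatorial) followed by the affine test on the single entry
`(i, j)` — crossing weight `1` — is `LRX_1`-disciplined from the all-fresh typing (with the typing that records the row test as a
row test). -/
theorem lrx_one_rowThenAffine (g : (Fin n → Bool) → Bool) (i : Fin m) (j : Fin n) (ψ : (Fin n → Bool) → Bool)
    (L₁ L₂ L₃ : Fin m × Fin n) :
    LRXDisciplined g 1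
      (KWTree.alice (fun X => ψ (row X i))
        (KWTree.bob (fun Y => Y (i, j)) (KWTree.leaf L₁) (KWTree.leaf L₂)) (KWTree.leaf L₃)) := by
  refine ⟨Function.update (fun _ => RowTypeX.fresh) i RowTypeX.combinatorial, 0,
    Or.inr (Or.inr ⟨i, ψ, fun X => rfl, rfl, rfl⟩), Nat.zero_le _, ?_, trivial⟩
  refine ⟨retagX {(i, j)} (Function.update (fun _ => RowTypeX.fresh) i RowTypeX.combinatorial), 1,
    Or.inr (Or.inl ⟨{(i, j)}, false, fun Y => by simp, rfl, ?_⟩), le_rfl, trivial, trivial⟩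
  unfold affWeight
  rw [eq_comm, Finset.card_eq_one]
  refine ⟨i, ?_⟩
  ext i'
  simp [eqRows, Finset.mem_filter, Function.update_apply]

end NonVacuity
end Summit.PneNP.PneNP.Theorems.KrwLrx
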